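import Literature.AlgebraicGeometry.Resolution.DefectlessDedekind
import Literature.AlgebraicGeometry.Resolution.QuasiExcellentClosedSubschemes
import Summits.ResolutionOfSingularities.ResolutionOfSingularities.Theorems.RadicialJungCleanModelsExcellentJapanese
import HarnessLib

/-!
# Route `RadicialJung`, crux `CleanModels` (stmt-ResolutionOfSingularities-15917), line `Sketch` rev 35, stub 6 `stub_cleanProp44` (X44c),
# work plan O8 / L7b, (T1-fact): a quasi-excellent discrete valuation ring (Dedekind domain) is a DEFECTLESS valued field

Memo `Cruxes/CleanModels/Lines/Sketch-memo-hand2-g8-stubs-5-7.md` §2 (T1) / §4 (i).  The hypothesis `hdef` of ✓ `exists_goodApprox_of_isDefectlessField`,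
✓ `exists_pointChain_cleanPermissibleAt_of_isDefectlessField` (p813508) and of the capstone ✓ `exists_pointChain_cleanPermissibleAt_or_pthPower_of_cleanRegAt`
(p813775) — «`IsDefectlessField (Frac D) W` for the valuation ring `W = D` of `Frac D`, `D = 𝒪_{X₀,x₀}/𝓘_{C₀,x₀}` the (discrete valuation) local
ring of the regular curve» — DISCHARGED for quasi-excellent `D` (in particular for the local rings of curves on excellent schemes):

* `isDefectlessField_valuationSubringAtPrime_of_isQuasiExcellentRing` — for a quasi-excellent Dedekind domain `D` and a non-zero prime `𝔭`,
  `(Frac D, D_𝔭)` is a defectless field: `D` is Japanese (✓ `module_finite_integralClosure_of_isQuasiExcellentRing`, EGA IV₂ (7.8.3) (vi)) and the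
  tree's Dedekind criterion ✓ `isDefectlessIn_of_finite_integralClosure` (`∑ eᵢfᵢ = n`, Mathlib's `Ideal.sum_ramification_inertia`) applies in
  every finite extension;
* `isDefectlessField_of_algebraMap_mem_of_isQuasiExcellentRing` — every valuation ring of `Frac D` containing `D` is defectless (it is `Frac D`
  or some `D_𝔭`, ✓ `exists_eq_valuationSubringAtPrime_of_le`);
* `isDefectlessField_of_mem_iff_of_isQuasiExcellentRing`, `isDefectlessField_quotient_of_isQuasiExcellentRing` — the literal `hdef` shapes
  (`W` = the image of `D`, resp. of `A ⧸ P` for a quasi-excellent `A` with `A ⧸ P` Dedekind — quotients of quasi-excellent rings are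
  quasi-excellent, ✓ `IsQuasiExcellentRing.of_surjective`).

Honest framing: OURS as arranged (Kuhlmann 2010 §1: defectless fields; Serre, Corps locaux I §4 Prop. 10 / Bourbaki AC VI §8 n°5 Thm. 2: `∑ eᵢfᵢ = n`
iff the integral closure is finite; EGA IV₂ (7.8.3) (vi): excellent rings are universally Japanese); nothing here proves resolution in
characteristic `p`, X44c, or any case of `CleanModels`.
-/

noncomputable section

set_option linter.dupNamespace false -- mandated namespace of this single-conjunct summit

open IsLocalRing IsDedekindDomain IsDedekindDomain.HeightOneSpectrum Literature.AlgebraicGeometry.Resolution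

namespace Summit.ResolutionOfSingularities.ResolutionOfSingularities.Theorems.RadicialJung.CleanModels

universe u

/-- **The local rings of a quasi-excellent Dedekind domain are defectless valued fields**: for a non-zero prime `𝔭` of a quasi-excellent
Dedekind domain `D` with fraction field `F`, `(F, D_𝔭)` is defectless in every finite extension `L/F` — the integral closure of `D` in `L` is
finite (`D` is Japanese) and `∑_{𝔓 ∣ 𝔭} e(𝔓|𝔭) f(𝔓|𝔭) = [L : F]`. [cite: Kuhlmann2010, Section 1 (p. 3 of arXiv:1003.5678)]
[cite: EGAIV2, (7.8.3) (vi) with (7.6.4) and (7.7.2)] -/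
theorem isDefectlessField_valuationSubringAtPrime_of_isQuasiExcellentRing {D F : Type u} [CommRing D] [IsDedekindDomain D]
    (hD : IsQuasiExcellentRing D) [Field F] [Algebra D F] [IsFractionRing D F] (v : HeightOneSpectrum D) :
    IsDefectlessField F (valuationSubringAtPrime F v) := by
  intro L _ _ hfin
  letI : Algebra D L := ((algebraMap F L).comp (algebraMap D F)).toAlgebra
  haveI : IsScalarTower D F L := IsScalarTower.of_algebraMap_eq fun _ => rfl
  haveI : Module.Finite D (integralClosure D L) := module_finite_integralClosure_of_isQuasiExcellentRing hD F L
  exact isDefectlessIn_of_finite_integralClosure v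

/-- **Every valuation ring of `Frac D` containing a quasi-excellent Dedekind domain `D` is a defectless valued field** (it is `Frac D` —
trivially valued, `isDefectlessField_top` — or `D_𝔭` for its centre `𝔭`). [cite: Kuhlmann2010, Section 1 (p. 3 of arXiv:1003.5678)]
[cite: EGAIV2, (7.8.3) (vi) with (7.6.4) and (7.7.2)] -/
theorem isDefectlessField_of_algebraMap_mem_of_isQuasiExcellentRing {D F : Type u} [CommRing D] [IsDedekindDomain D]
    (hD : IsQuasiExcellentRing D) [Field F] [Algebra D F] [IsFractionRing D F] (O : ValuationSubring F)
    (hO : ∀ a : D, algebraMap D F a ∈ O) : IsDefectlessField F O := by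
  by_cases hO' : O = ⊤
  · rw [hO']
    exact isDefectlessField_top F
  · obtain ⟨v, rfl⟩ := exists_eq_valuationSubringAtPrime_of_le O hO hO'
    exact isDefectlessField_valuationSubringAtPrime_of_isQuasiExcellentRing hD v

/-- The `hdef` shape of ✓ `exists_goodApprox_of_isDefectlessField` for `W` = the image of a quasi-excellent Dedekind domain (e.g. an excellent
discrete valuation ring) `D` in `Frac D`: `(Frac D, W)` is a defectless field. [cite: Kuhlmann2010, Section 1 (p. 3 of arXiv:1003.5678)]
[cite: EGAIV2, (7.8.3) (vi) with (7.6.4) and (7.7.2)] -/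
theorem isDefectlessField_of_mem_iff_of_isQuasiExcellentRing {D : Type u} [CommRing D] [IsDedekindDomain D] (hD : IsQuasiExcellentRing D)
    {F : Type u} [Field F] [Algebra D F] [IsFractionRing D F]
    (W : ValuationSubring F) (hW : ∀ x, x ∈ W ↔ ∃ d : D, algebraMap D F d = x) : IsDefectlessField F W :=
  isDefectlessField_of_algebraMap_mem_of_isQuasiExcellentRing hD W fun a => (hW _).mpr ⟨a, rfl⟩

/-- **The literal hypothesis `hdef` of ✓ `exists_goodApprox_of_isDefectlessField` / ✓ `exists_pointChain_cleanPermissibleAt_of_isDefectlessField` /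
✓ `exists_pointChain_cleanPermissibleAt_or_pthPower_of_cleanRegAt`, DISCHARGED for quasi-excellent `A`**: if `A` is quasi-excellent (e.g. the
local ring of an excellent scheme) and `A ⧸ P` is a Dedekind domain (e.g. the discrete valuation ring of a regular curve through a regular
point), then for every valuation ring `W` of `Frac (A ⧸ P)` consisting exactly of the image of `A ⧸ P`, `(Frac (A ⧸ P), W)` is a defectless
field. [cite: Kuhlmann2010, Section 1 (p. 3 of arXiv:1003.5678)] [cite: EGAIV2, (7.8.3) (vi) with (7.6.4) and (7.7.2)] -/
theorem isDefectlessField_quotient_of_isQuasiExcellentRing {A : Type u} [CommRing A] (hA : IsQuasiExcellentRing A) (P : Ideal A)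
    [IsDedekindDomain (A ⧸ P)] :
    ∀ W : ValuationSubring (FractionRing (A ⧸ P)),
      (∀ x, x ∈ W ↔ ∃ a : A ⧸ P, algebraMap (A ⧸ P) (FractionRing (A ⧸ P)) a = x) → IsDefectlessField (FractionRing (A ⧸ P)) W :=
  fun W hW => isDefectlessField_of_mem_iff_of_isQuasiExcellentRing
    (IsQuasiExcellentRing.of_surjective (Ideal.Quotient.mk P) Ideal.Quotient.mk_surjective hA) W hW

end Summit.ResolutionOfSingularities.ResolutionOfSingularities.Theorems.RadicialJung.CleanModels

end
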